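import Summits.Parity.GeneralizedHardyLittlewood.Theses.PrimeLevelFamEdge
import HarnessLib

/-!
# Route `PrimeLevelFamEdge` — TYPED IDEA DELTAS, deck 22: `rescuer` lens — K-L19-2 «CONSUMER TOLERANCE OF THE ∀-LEVEL
# BINDER» (cell ls-idea, seat ls-idea-lens-19 gens 2–3, card K-L19-2; the seat's `Sketch_L19_w2.lean` v2.1 sha16
# aa0ed357c21de753, critic E b10 PASS as LEDGER/INSTRUMENT (variant · value-neutral · NOT ★ · 0 levers); LANDING NOTE
# typer ls-idea-typ-1 gen 3: VERBATIM up to (i) namespace `…Theses.PrimeLevelFamEdge.L19w2` →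
# `…Theorems.PrimeLevelFamEdgeIdeaDeltas.Rescuer`, (ii) this header, (iii) docstrings added on the small lemmas.)

The ONE-MODULUS death and its consumer-side dodge, TYPED.  Death rescued (attempted): the BN-7a / p594208 class — every
bulk line for K_A = `PrimeLevelFamEdge.MomentsBeyondDiagonal` dies at «beat Parseval for the bilinear Kloosterman form
at ONE prime modulus `q`»; the recorded witness (`parsevalBound_attained_iff`, one-level character tables) is a ONE-LEVEL
identity.  The dodge typed here is CONSUMER-SIDE: the route's deciding theorem `closes` consumes K_A only through
`primeLevelFamilyTwo.EStarFam p₁ 2` and then through ONE Linnik-supplied compatible prime level per conductor `D`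
(`CentralValueFamily.CompatibleSupply`, tree `primeLevelFamilyTwo_compatibleSupply`).  Hence the `∀ prime q ≥ q₀` binder
of K_A may be weakened to «all primes outside an exceptional set `E`» exactly as far as the Linnik supply survives
removal of `E`:
* `MomentAsymptoticsOff E` / `MomentsBeyondDiagonalOffSparse` — K_A off a POWER-SPARSE set of levels (`PowerSparse E`:
  `#(E ∩ [0,X]) ≤ X^{1-δ}` for large `X`); K_A ⇒ it (`E = ∅`), PROVED below;
* `CompatibleSupplyOff E δ K` / `SupplyToleratesSparse` — the re-threaded supply the leaf glue would need (TARGET, not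
  proved here; source: quantitative Linnik = the tree's `Literature.NumberTheory.Sieve.Linnik.theta_pos_of_lemma43`
  machinery read as a COUNT, plus `#E(2N) ≤ (2N)^{1-δ_E}`); «almost all levels» (relative density one) is NOT a door
  currency: in world (A) with an even exceptional character the compatible primes below `D^A` are themselves power-thin
  (Deuring–Heilbronn), card K-L19-2 (C3), HOME/cards/ls-idea-lens-19.md.

HONESTY: typed ≠ proved; nothing here evaluates a moment, proves K_A (stmt-Parity-20007) or its dodge, or excludes an
exceptional zero (no Landau–Siegel / Siegel-zero exclusion, no Theorem 1–2 of arXiv:2211.02515, no repaired Margin232).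
-/

noncomputable section

open scoped Real
open Polynomial
open Literature.NumberTheory.LFunctions

namespace Summit.Parity.GeneralizedHardyLittlewood.Theorems.PrimeLevelFamEdgeIdeaDeltas.Rescuer

open Summit.Parity.GeneralizedHardyLittlewood.Theses.PrimeLevelFamEdge

/-- A set of natural numbers (levels) is POWER-SPARSE: `#(E ∩ [0,X]) ≤ X^{1-δ}` for some `δ > 0`
and all large `X`. -/
def PowerSparse (E : Set ℕ) : Prop :=
  ∃ δ : ℝ, 0 < δ ∧ ∃ X₀ : ℕ, ∀ X : ℕ, X₀ ≤ X → ((E ∩ Set.Iic X).ncard : ℝ) ≤ (X : ℝ) ^ (1 - δ)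

/-- `KMV2000.MomentAsymptotics` with the prime-level binder restricted to levels OUTSIDE `E`
(verbatim copy of the tree predicate with the single extra hypothesis `q ∉ E`). -/
def MomentAsymptoticsOff (E : Set ℕ) (Δlo Δhi : ℝ) (T₁ T₂ : ℝ → ℝ[X] → ℝ[X] → ℝ) : Prop :=
  ∀ P Q : ℝ[X], KMV2000.Admissible P → KMV2000.IsEvenOrOdd Q → ∀ Δ : ℝ, Δlo < Δ → Δ ≤ Δhi →
    ∃ C : ℝ, ∃ q₀ : ℕ, ∀ (q : ℕ) [NeZero q], q.Prime → q₀ ≤ q → q ∉ E →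
      (∀ n : ℕ, (n : ℝ) ≠ KMV2000.qhat q ^ Δ) →
        ‖KMV2000.LhPQ q P Q (KMV2000.qhat q ^ Δ) -
            ((riemannZeta 2 * ((Real.sqrt (KMV2000.qhat q) / (Δ * Real.log (KMV2000.qhat q)) : ℝ) : ℂ)) *
              ((KMV2000.linForm Δ P Q + T₁ Δ P Q : ℝ) : ℂ))‖ ≤
          C * Real.sqrt (KMV2000.qhat q) * (Real.log (KMV2000.qhat q))⁻¹ ^ 2 ∧
        ‖KMV2000.QhPQ q P Q (KMV2000.qhat q ^ Δ) -
            ((2 * riemannZeta 2 ^ 2 * ((KMV2000.qhat q / (Δ ^ 2 * Real.log (KMV2000.qhat q) ^ 2) : ℝ) : ℂ)) *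
              ((KMV2000.secondMomentForm Δ P Q + T₂ Δ P Q : ℝ) : ℂ))‖ ≤
          C * KMV2000.qhat q * (Real.log (KMV2000.qhat q))⁻¹ ^ 3

/-- **K_A off a power-sparse set of prime levels** — the consumer-side dodge of the one-modulus
death: the moment asymptotics beyond the diagonal at every large prime level outside some
power-sparse exceptional set. Strictly weaker than `MomentsBeyondDiagonal` as a statement
(`offSparse_of_momentsBeyondDiagonal`); whether it is EASIER is answered NO in the card (the only
technologies that see a set of levels — level-averaged large sieve / BDH — land at the un-mollified
threshold, and a power-sparse exceptional set needs a POWER saving in the prime-level mean square,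
i.e. horizontal cancellation of Kloosterman products over prime moduli). -/
def MomentsBeyondDiagonalOffSparse : Prop :=
  ∃ E : Set ℕ, PowerSparse E ∧ ∃ Δ : ℝ, 1 < Δ ∧ ∃ T₁ T₂ : ℝ → ℝ[X] → ℝ[X] → ℝ,
    MomentAsymptoticsOff E 1 Δ T₁ T₂

/-- The tree's `MomentAsymptotics` implies its restriction off any set of levels. -/
theorem momentAsymptoticsOff_of_momentAsymptotics {Δlo Δhi : ℝ} {T₁ T₂ : ℝ → ℝ[X] → ℝ[X] → ℝ}
    (h : KMV2000.MomentAsymptotics Δlo Δhi T₁ T₂) (E : Set ℕ) :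
    MomentAsymptoticsOff E Δlo Δhi T₁ T₂ := by
  intro P Q hP hQ Δ h₁ h₂
  obtain ⟨C, q₀, H⟩ := h P Q hP hQ Δ h₁ h₂
  exact ⟨C, q₀, fun q _ hq hq₀ _ hM => H q hq hq₀ hM⟩

/-- Monotone in the exempted set. -/
theorem momentAsymptoticsOff_mono {E E' : Set ℕ} (hEE' : E ⊆ E') {Δlo Δhi : ℝ}
    {T₁ T₂ : ℝ → ℝ[X] → ℝ[X] → ℝ} (h : MomentAsymptoticsOff E Δlo Δhi T₁ T₂) :
    MomentAsymptoticsOff E' Δlo Δhi T₁ T₂ := by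
  intro P Q hP hQ Δ h₁ h₂
  obtain ⟨C, q₀, H⟩ := h P Q hP hQ Δ h₁ h₂
  exact ⟨C, q₀, fun q _ hq hq₀ hqE hM => H q hq hq₀ (fun h' => hqE (hEE' h')) hM⟩

/-- The empty set is power-sparse. -/
theorem powerSparse_empty : PowerSparse (∅ : Set ℕ) := by
  refine ⟨1 / 2, by norm_num, 0, fun X _ => ?_⟩
  simp only [Set.empty_inter, Set.ncard_empty, Nat.cast_zero]
  exact Real.rpow_nonneg (Nat.cast_nonneg _) _

/-- Every finite set is power-sparse. -/
theorem powerSparse_of_finite {E : Set ℕ} (hE : E.Finite) : PowerSparse E := by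
  refine ⟨1 / 2, by norm_num, E.ncard ^ 2, fun X hX => ?_⟩
  have h1 : ((E ∩ Set.Iic X).ncard : ℝ) ≤ (E.ncard : ℝ) := by
    exact_mod_cast Set.ncard_le_ncard Set.inter_subset_left hE
  have h2 : ((E.ncard : ℝ)) ^ (2 : ℝ) ≤ (X : ℝ) := by
    have : ((E.ncard ^ 2 : ℕ) : ℝ) ≤ (X : ℝ) := by exact_mod_cast hX
    simpa [Real.rpow_natCast, Nat.cast_pow] using this
  have h3 : (E.ncard : ℝ) ≤ (X : ℝ) ^ (1 - 1 / 2 : ℝ) := by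
    have h0 : (0 : ℝ) ≤ E.ncard := Nat.cast_nonneg _
    calc (E.ncard : ℝ) = (((E.ncard : ℝ)) ^ (2 : ℝ)) ^ (1 / 2 : ℝ) := by
            rw [← Real.rpow_mul h0]; norm_num
      _ ≤ (X : ℝ) ^ (1 / 2 : ℝ) := by
            exact Real.rpow_le_rpow (by positivity) h2 (by norm_num)
      _ = (X : ℝ) ^ (1 - 1 / 2 : ℝ) := by norm_num
  exact h1.trans h3

/-- Vacuity guard (card K-L19-2 (E-D)): exempting EVERY level is not allowed — `Set.univ` is not
power-sparse, so `MomentsBeyondDiagonalOffSparse` cannot be made vacuous by the choice of `E`. -/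
theorem not_powerSparse_univ : ¬ PowerSparse (Set.univ : Set ℕ) := by
  rintro ⟨δ, hδ, X₀, h⟩
  have hX := h (max X₀ 1) (le_max_left _ _)
  set X : ℕ := max X₀ 1 with hXdef
  have hX1 : (1 : ℝ) ≤ (X : ℝ) := by exact_mod_cast (le_max_right X₀ 1)
  have hcard : ((Set.univ ∩ Set.Iic X).ncard : ℝ) = (X : ℝ) + 1 := by
    rw [Set.univ_inter, Set.ncard_Iic_nat]; push_cast; ring
  have hle : (X : ℝ) ^ (1 - δ) ≤ (X : ℝ) := by
    calc (X : ℝ) ^ (1 - δ) ≤ (X : ℝ) ^ (1 : ℝ) :=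
          Real.rpow_le_rpow_of_exponent_le hX1 (by linarith)
      _ = X := Real.rpow_one _
  rw [hcard] at hX
  linarith

/-- K_A ⇒ the dodge (take `E = ∅`). -/
theorem offSparse_of_momentsBeyondDiagonal (h : MomentsBeyondDiagonal) :
    MomentsBeyondDiagonalOffSparse := by
  obtain ⟨Δ, hΔ, T₁, T₂, hMA⟩ := h
  exact ⟨∅, powerSparse_empty, Δ, hΔ, T₁, T₂, momentAsymptoticsOff_of_momentAsymptotics hMA ∅⟩

/-! ## The consumer re-thread the dodge would require (TARGETS, typed only) -/

/-- `CompatibleSupply` of the weight-2 prime-level family AVOIDING the levels in `E`: for every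
large `D` and real primitive `χ mod D` an admissible `χ`-compatible parameter of size in
`[max(D, D^{1/δ}), D^K]` whose size is not (the cast of) an element of `E`. -/
def CompatibleSupplyOff (E : Set ℕ) (δ K : ℝ) : Prop :=
  ∃ D₀ : ℕ, ∀ (D : ℕ) [NeZero D] (χ : DirichletCharacter ℂ D), D₀ ≤ D → χ.IsPrimitive →
    MulChar.IsQuadratic χ →
      ∃ P : CentralValueFamilyHalfEdge.primeLevelFamilyTwo.Param,
        CentralValueFamilyHalfEdge.primeLevelFamilyTwo.Admissible P ∧
        CentralValueFamilyHalfEdge.primeLevelFamilyTwo.Compatible P χ ∧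
        (D : ℝ) ≤ CentralValueFamilyHalfEdge.primeLevelFamilyTwo.size P ∧
        (D : ℝ) ≤ CentralValueFamilyHalfEdge.primeLevelFamilyTwo.size P ^ δ ∧
        CentralValueFamilyHalfEdge.primeLevelFamilyTwo.size P ≤ (D : ℝ) ^ K ∧
        ∀ n : ℕ, n ∈ E → (n : ℝ) ≠ CentralValueFamilyHalfEdge.primeLevelFamilyTwo.size P

/-- **Consumer tolerance (TARGET, support-sized)**: the Linnik supply survives the removal of ANY
power-sparse set of levels, in every uniformity range `δ`. Source for a proof: the tree's
Gallagher–Linnik positivity `Literature.NumberTheory.Sieve.Linnik.theta_pos_of_lemma43` read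
quantitatively (a COUNT `≫ N^{1-O(1/A)}` of primes `≡ -1 (mod D·ℓ^t)`-compatible in `[N,2N]`,
`N = P^A`) against `#(E ∩ [0,2N]) ≤ (2N)^{1-δ_E}` (Iwaniec–Kowalski §18.4). With «relative
density one» in place of `PowerSparse` no such theorem is available: compatibility is `χ(-p) = 1`
(half of the classes mod `D`), and in world (A) with `χ_D(-1) = 1` the compatible primes below `D^A`
are power-thin, so a density-one set of good levels may contain no compatible level (card K-L19-2
(C3)); the count above is exactly what survives inside world (A). -/
def SupplyToleratesSparse : Prop :=
  ∀ E : Set ℕ, PowerSparse E → ∀ δ : ℝ, 0 < δ → ∃ K : ℝ, 0 < K ∧ CompatibleSupplyOff E δ K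

/-- Sanity: with `E = ∅` the re-threaded supply is the tree's supply. -/
theorem compatibleSupplyOff_empty {δ K : ℝ}
    (h : CentralValueFamilyHalfEdge.primeLevelFamilyTwo.CompatibleSupply δ K) :
    CompatibleSupplyOff ∅ δ K := by
  obtain ⟨D₀, H⟩ := h
  refine ⟨D₀, fun D _ χ hD hprim hquad => ?_⟩
  obtain ⟨P, h1, h2, h3, h4, h5⟩ := H D χ hD hprim hquad
  exact ⟨P, h1, h2, h3, h4, h5, fun n hn => by simp at hn⟩

end Summit.Parity.GeneralizedHardyLittlewood.Theorems.PrimeLevelFamEdgeIdeaDeltas.Rescuer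

end
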